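import Summits.CriticalPhenomena.PercolationContinuityZ3.Theorems.PercNearOneGluingNoHeavyLowerTailCILOwnEdgeStability
import HarnessLib

/-!
# `NoHeavyLowerTail` (stmt-CriticalPhenomena-4575) — one-bond recursion for set-champion stability at an edge of the WITNESS

Support file (prover `prim-gen-induct`; `--supports stmt-CriticalPhenomena-4575`).  No definitions, no named facts, no sorries.

Notation as in `…CILOwnEdgeStability` / `…CILInduction`: `μ_w = prodBernoulli w` on `Fin n`, relays `A`, level `j`,
`I_w(x) = μ_w{|π(x)| ≤ j}`, and for a vertex set `S` and a vertex `c`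
`CS_w(S, c) : μ_w(c ↮ S, 1 ≤ |π(S)| ≤ j) ≤ μ_w(c ↮ S, |π(c)| ≤ j)`.

* `CutObserver.setCS_of_witnessEdge` — for ANY pair `e`: `CS_{w[e↦0]}(S, c)` and `CS_{w[e↦1]}(S, c)` imply `CS_w(S, c)`
  (both sides of `CS_w` are affine in the weight of `e`, `stub_oneBondDecomp_k15`).
* `CutObserver.setCS_of_witnessEdge_champion` — if `c ∈ A` is a CHAMPION of `w`, `v ≠ c`, `w s(c,v) < 1`, and set-champion
  stability holds below `w` in the sense that `CS_{w[s(c,v)↦0]}(S, c')` holds for every champion `c'` of `w[s(c,v)↦0]`, then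
  `CS_w(S, c)` follows from the GLUED instance `CS_{w[s(c,v)↦1]}(S, c)` alone: the deleted instance is discharged by own-edge
  stability (`champion_of_erase_own_edge`: `c` is still a champion of `w[s(c,v)↦0]`).

Role (crux notes, gen 2, "rule R2" of the certificate calculus): together with edge raising at the observer set (Prop B,
`…CILEdgeRaising`) and own-edge stability, this is the witness-side move of the recursive certificate for `CS_w(S, champ(w))`;
in the exact census (n ≤ 8, |S| ≤ 3, 7 000+ instances) the calculus {heavy member, raising, witness edge, J-up-set,
induction below} certifies every champion, the witness-edge move covering most champions not adjacent to `S`.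
-/

noncomputable section

namespace Summit.CriticalPhenomena.PercolationContinuityZ3.Theorems

open MeasureTheory Set Literature.Probability.LatticeModels Literature.Probability.Percolation
open scoped Classical BigOperators

variable {n : ℕ}

namespace CutObserver

/-- **One-bond recursion for `CS` at an arbitrary pair.**  For any pair `e`, if `CS_{w[e↦0]}(S, c)` and `CS_{w[e↦1]}(S, c)`
then `CS_w(S, c)`: both measures in `CS_w(S, c)` are affine in the weight of `e` with the same coefficients
(`stub_oneBondDecomp_k15`). [folklore] -/
theorem setCS_of_witnessEdge (w : Sym2 (Fin n) → unitInterval) (A S : Finset (Fin n)) (c : Fin n) (j : ℕ)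
    (e : Sym2 (Fin n))
    (h₀ : (prodBernoulli (Function.update w e 0)).real {ω : BondConfig (Fin n) |
        (∀ x ∈ S, ω ∉ openConn c x) ∧ 1 ≤ (A.filter fun z => ∃ x ∈ S, ω ∈ openConn x z).card ∧
        (A.filter fun z => ∃ x ∈ S, ω ∈ openConn x z).card ≤ j} ≤
      (prodBernoulli (Function.update w e 0)).real {ω : BondConfig (Fin n) |
        (∀ x ∈ S, ω ∉ openConn c x) ∧ (A.filter fun z => ω ∈ openConn c z).card ≤ j})
    (h₁ : (prodBernoulli (Function.update w e 1)).real {ω : BondConfig (Fin n) |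
        (∀ x ∈ S, ω ∉ openConn c x) ∧ 1 ≤ (A.filter fun z => ∃ x ∈ S, ω ∈ openConn x z).card ∧
        (A.filter fun z => ∃ x ∈ S, ω ∈ openConn x z).card ≤ j} ≤
      (prodBernoulli (Function.update w e 1)).real {ω : BondConfig (Fin n) |
        (∀ x ∈ S, ω ∉ openConn c x) ∧ (A.filter fun z => ω ∈ openConn c z).card ≤ j}) :
    (prodBernoulli w).real {ω : BondConfig (Fin n) |
        (∀ x ∈ S, ω ∉ openConn c x) ∧ 1 ≤ (A.filter fun z => ∃ x ∈ S, ω ∈ openConn x z).card ∧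
        (A.filter fun z => ∃ x ∈ S, ω ∈ openConn x z).card ≤ j} ≤
      (prodBernoulli w).real {ω : BondConfig (Fin n) |
        (∀ x ∈ S, ω ∉ openConn c x) ∧ (A.filter fun z => ω ∈ openConn c z).card ≤ j} := by
  set LS := {ω : BondConfig (Fin n) |
    (∀ x ∈ S, ω ∉ openConn c x) ∧ 1 ≤ (A.filter fun z => ∃ x ∈ S, ω ∈ openConn x z).card ∧
    (A.filter fun z => ∃ x ∈ S, ω ∈ openConn x z).card ≤ j} with hLS
  set RS := {ω : BondConfig (Fin n) |
    (∀ x ∈ S, ω ∉ openConn c x) ∧ (A.filter fun z => ω ∈ openConn c z).card ≤ j} with hRS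
  have hp0 : 0 ≤ (w e : ℝ) := (w e).2.1
  have hp1 : (w e : ℝ) ≤ 1 := (w e).2.2
  rw [stub_oneBondDecomp_k15 n w e LS, stub_oneBondDecomp_k15 n w e RS]
  have ha : (1 - (w e : ℝ)) * (prodBernoulli (Function.update w e 0)).real LS ≤
      (1 - (w e : ℝ)) * (prodBernoulli (Function.update w e 0)).real RS :=
    mul_le_mul_of_nonneg_left h₀ (by linarith)
  have hb : (w e : ℝ) * (prodBernoulli (Function.update w e 1)).real LS ≤
      (w e : ℝ) * (prodBernoulli (Function.update w e 1)).real RS :=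
    mul_le_mul_of_nonneg_left h₁ hp0
  exact add_le_add ha hb

/-- **Witness-edge move for the champion.**  Let `c ∈ A` be a level-`j` champion of `w`, `v ≠ c` a vertex with
`w s(c,v) < 1`, and suppose set-champion stability `CS_{w[s(c,v)↦0]}(S, c')` is known for every champion `c'` of the
weight function `w[s(c,v) ↦ 0]` (e.g. by an induction on the number of positive pairs).  Then `CS_w(S, c)` follows from
the glued instance `CS_{w[s(c,v)↦1]}(S, c)`: by own-edge stability `c` is a champion of `w[s(c,v)↦0]`, so the deleted
instance holds, and `setCS_of_witnessEdge` combines the two. [folklore] -/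
theorem setCS_of_witnessEdge_champion (w : Sym2 (Fin n) → unitInterval) (A S : Finset (Fin n)) (c v : Fin n)
    (j : ℕ) (hcv : c ≠ v) (hw1 : (w s(c, v) : ℝ) < 1)
    (hchamp : ∀ a ∈ A,
      (prodBernoulli w).real {ω : BondConfig (Fin n) | (A.filter fun z => ω ∈ openConn a z).card ≤ j} ≤
        (prodBernoulli w).real {ω : BondConfig (Fin n) | (A.filter fun z => ω ∈ openConn c z).card ≤ j})
    (hbelow : ∀ c' : Fin n,
      (∀ a ∈ A,
        (prodBernoulli (Function.update w s(c, v) 0)).real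
            {ω : BondConfig (Fin n) | (A.filter fun z => ω ∈ openConn a z).card ≤ j} ≤
          (prodBernoulli (Function.update w s(c, v) 0)).real
            {ω : BondConfig (Fin n) | (A.filter fun z => ω ∈ openConn c' z).card ≤ j}) →
      (prodBernoulli (Function.update w s(c, v) 0)).real {ω : BondConfig (Fin n) |
          (∀ x ∈ S, ω ∉ openConn c' x) ∧ 1 ≤ (A.filter fun z => ∃ x ∈ S, ω ∈ openConn x z).card ∧
          (A.filter fun z => ∃ x ∈ S, ω ∈ openConn x z).card ≤ j} ≤
        (prodBernoulli (Function.update w s(c, v) 0)).real {ω : BondConfig (Fin n) |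
          (∀ x ∈ S, ω ∉ openConn c' x) ∧ (A.filter fun z => ω ∈ openConn c' z).card ≤ j})
    (h₁ : (prodBernoulli (Function.update w s(c, v) 1)).real {ω : BondConfig (Fin n) |
        (∀ x ∈ S, ω ∉ openConn c x) ∧ 1 ≤ (A.filter fun z => ∃ x ∈ S, ω ∈ openConn x z).card ∧
        (A.filter fun z => ∃ x ∈ S, ω ∈ openConn x z).card ≤ j} ≤
      (prodBernoulli (Function.update w s(c, v) 1)).real {ω : BondConfig (Fin n) |
        (∀ x ∈ S, ω ∉ openConn c x) ∧ (A.filter fun z => ω ∈ openConn c z).card ≤ j}) :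
    (prodBernoulli w).real {ω : BondConfig (Fin n) |
        (∀ x ∈ S, ω ∉ openConn c x) ∧ 1 ≤ (A.filter fun z => ∃ x ∈ S, ω ∈ openConn x z).card ∧
        (A.filter fun z => ∃ x ∈ S, ω ∈ openConn x z).card ≤ j} ≤
      (prodBernoulli w).real {ω : BondConfig (Fin n) |
        (∀ x ∈ S, ω ∉ openConn c x) ∧ (A.filter fun z => ω ∈ openConn c z).card ≤ j} :=
  setCS_of_witnessEdge w A S c j s(c, v) (hbelow c (champion_of_erase_own_edge w A c v j hcv hw1 hchamp)) h₁

end CutObserver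

end Summit.CriticalPhenomena.PercolationContinuityZ3.Theorems

end
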